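import Literature.AlgebraicGeometry.Limits.SubalgebraGroupSpread
import HarnessLib

/-!
# Limits of schemes: endomorphisms of a group scheme over `Spec B`, `B = ⋃ K[t]`, descend to a finitely
# generated subalgebra together with the group law (EGA IV₃ 8.8.2 (i); Stacks 01ZC)

Topic `Literature/AlgebraicGeometry/Limits`; sequel of `Limits/SubalgebraGroupSpread` (same notation:
`K` a commutative ring, `B` a `K`-algebra, the stages `Spec K[t]`, `t ⊇ s₁` finite, of `Spec B = lim_t Spec K[t]`,
a `K`-scheme `P`, `P_B = P ×_K Spec B` (`limObj`), `P_t = P ×_K Spec K[t]` (`stageObj`), the restriction functor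
`legPullback t : Over (Spec K[t]) ⥤ Over (Spec B)` and the canonical `(P_t)_B ≅ P_B` (`legFacObjIso`)).

WHAT IS PROVED (everything; no definition, no named fact):
* §1 `LiftedGrpData.isMonHom_of_map` — the categorical core (sequel of `Limits/GrpTransfer`): for a monoidal
  functor `F` injective on maps into `N` and a group structure on `N` LIFTED from one on `F N`
  (`LiftedGrpData.grpObj`), an endomorphism `ψ` of `N` is a homomorphism as soon as `F ψ` is one.
* §2 `SubalgGrpSpread.exists_stage_map_eq_conj` — every endomorphism `φ` of the `B`-scheme `P_B` is, for
  some stage `t` (below any prescribed `t₀`), the restriction of an endomorphism `ψ` of the `K[t]`-scheme `P_t`: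
  `(ψ)_B = e ∘ φ ∘ e⁻¹` with `e : (P_t)_B ≅ P_B` (Stacks 01ZC, surjectivity, `exists_whiskerLeft_comp_eq`);
  `map_restrictStage_eq_conj` — such lifts restrict to finer stages.
* §3 `GrpSpread.isMonHom_of_map_eq_conj` — if the group law of `P_B` has been descended to the flat
  separated stage `P_t` (`GrpSpread.grpObj`) and `φ` is a homomorphism of `B`-group schemes, then the lift `ψ`
  is a homomorphism of `K[t]`-group schemes; `stage_hom_ext_of_map_eq` — lifts are unique;
  `comp_eq_of_map_eq_conj`, `lift_mul_eq_of_map_eq_conj` — composites and products (sums) of endomorphisms of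
  `P_B` lift to the composites and products of the lifts (so every finite presentation of a ring of
  endomorphisms of `P_B`, e.g. an action of an order `𝓞` by a `ℤ`-basis and its multiplication table,
  descends to `P_t`); `exists_stage_forall_map_eq_conj` — finitely many endomorphisms lift to ONE stage.

Use (cell `hodgecm-mathlib`, row II-2β `shimura1998_prop26_definedOverQbar`, step (S1) «spread the structure
(A, ι) over a finitely generated ℚ̄-subalgebra of ℂ»): with `K = T` the base of a smooth projective model,
`B = ℂ`, `P` the model and `φ = ι(a)`, this file supplies the endomorphisms of the spread-out group scheme.

## References
* [EGAIV3] A. Grothendieck, EGA IV₃ (Publ. Math. IHÉS 28, 1966), Thm. 8.8.2 (i).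
* [StacksProject] The Stacks project, Tags 01ZC, 01ZM.
* [GortzWedhorn2020] U. Görtz, T. Wedhorn, *Algebraic Geometry I*, 2nd ed. (2020), Thm. 10.57, §(4.7).
-/

noncomputable section

universe u

open CategoryTheory CategoryTheory.Limits AlgebraicGeometry MonoidalCategory
  CartesianMonoidalCategory MonObj
open Functor.LaxMonoidal Functor.OplaxMonoidal
open scoped CategoryTheory.Obj

namespace Literature.AlgebraicGeometry.Limits

/-! ## §1 Homomorphisms for a lifted group structure -/

section Transfer

universe v₁ v₂ u₁ u₂

variable {C : Type u₁} [Category.{v₁} C] [CartesianMonoidalCategory C]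
  {D : Type u₂} [Category.{v₂} D] [CartesianMonoidalCategory D]
  {F : C ⥤ D} [F.Monoidal] {N : C} [GrpObj (F.obj N)] {P : C → Prop}

/-- **An endomorphism whose image is a homomorphism is a homomorphism for the lifted structure.**  Let
`h : LiftedGrpData F N P` (so `F` is injective on maps `X ⟶ N`, `X ∈ P ∋ 𝟙, N`, and the group structure of
`F N` lifts to `N`, `h.grpObj`) and let `ψ : N ⟶ N` be such that `F ψ` is a homomorphism of the group object
`F N`.  Then `ψ` is a homomorphism for `h.grpObj`: both axioms are equalities of maps `𝟙 ⟶ N`, `N ⊗ N ⟶ N`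
that hold after `F` (EGA IV₃ 8.8.2 (i), uniqueness at a finite stage). [cite: EGAIV3, Thm. 8.8.2 (i)] -/
theorem LiftedGrpData.isMonHom_of_map (h : LiftedGrpData F N P) (ψ : N ⟶ N) [IsMonHom (F.map ψ)] :
    letI : GrpObj N := h.grpObj
    IsMonHom ψ := by
  have e₁ : η[F.obj N] ≫ F.map ψ = η[F.obj N] := IsMonHom.one_hom (F.map ψ)
  have e₂ : μ[F.obj N] ≫ F.map ψ = (F.map ψ ⊗ₘ F.map ψ) ≫ μ[F.obj N] := IsMonHom.mul_hom (F.map ψ)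
  letI : GrpObj N := h.grpObj
  refine { one_hom := ?_, mul_hom := ?_ }
  · refine h.map_injective h.unit ?_
    change F.map (h.one ≫ ψ) = F.map h.one
    rw [F.map_comp, h.map_one, Category.assoc, e₁]
  · refine h.map_injective (h.tensor _ _ h.self h.self) ?_
    change F.map (h.mul ≫ ψ) = F.map ((ψ ⊗ₘ ψ) ≫ h.mul)
    rw [F.map_comp, h.map_mul, Category.assoc, e₂, F.map_comp, h.map_mul, δ_natural_assoc]

end Transfer

namespace SubalgGrpSpread

open Literature.AlgebraicGeometry.Motives (SchemeOver specOver)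
open SubalgApprox

set_option backward.isDefEq.respectTransparency false

variable {K : Type u} [CommRing K] (B : Type u) [CommRing B] [Algebra K B] (s₁ : Finset B)
  (P : SchemeOver K)

/-- The legs commute with the transition maps `Spec K[t] → Spec K[t']`, `t ⊇ t'`. [folklore] -/
@[reassoc]
private theorem baseLeg_comp_map' {t t' : (Idx B s₁)ᵒᵖ} (ρ : t ⟶ t') :
    baseLeg K B s₁ t ≫ (baseDiagram K B s₁).map ρ = baseLeg K B s₁ t' :=
  (baseCone K B s₁).w ρ

/-! ## §2 Endomorphisms of `P_B` spread out to a stage (Stacks 01ZC, surjectivity) -/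

/-- **Every endomorphism of the `B`-scheme `P_B` comes from a stage.**  Let `P → Spec K` be quasi-compact,
quasi-separated and locally of finite presentation.  For every `B`-endomorphism `φ` of `P_B = P ×_K Spec B` and
every stage `t₀` there are a finer stage `t` and a `K[t]`-endomorphism `ψ` of `P_t = P ×_K Spec K[t]` whose
base change to `Spec B` is `φ` (conjugated by the canonical `(P_t)_B ≅ P_B`): the `K`-morphism
`P ⊗ Spec B → P` underlying `φ` factors through some `P ⊗ Spec K[t]` (`exists_whiskerLeft_comp_eq`,
Stacks 01ZC) and the dictionary `K`-morphisms ↔ `K[t]`-morphisms commutes with base change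
(`pullback_map_sliceHom`). [cite: StacksProject, Tag 01ZC] [cite: EGAIV3, Thm. 8.8.2 (i)] [cite: GortzWedhorn2020, Thm. 10.57 and §(4.7) (4.7.1)] -/
theorem exists_stage_map_eq_conj [QuasiCompact P.hom] [QuasiSeparated P.hom]
    [LocallyOfFinitePresentation P.hom] (t₀ : (Idx B s₁)ᵒᵖ) (φ : limObj B P ⟶ limObj B P) :
    ∃ (t : (Idx B s₁)ᵒᵖ) (_ : t ⟶ t₀) (ψ : stageObj B s₁ P t ⟶ stageObj B s₁ P t),
      (legPullback K B s₁ t).map ψ =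
        (legFacObjIso B s₁ t P).hom ≫ φ ≫ (legFacObjIso B s₁ t P).inv := by
  obtain ⟨t₁, g, hg⟩ := exists_whiskerLeft_comp_eq B s₁ P (unsliceHom (specOver K B) φ)
  obtain ⟨t, ⟨ρ₀⟩, ⟨ρ₁⟩⟩ := exists_hom₂ B s₁ t₀ t₁
  refine ⟨t, ρ₀, sliceHom ((baseDiagram K B s₁).obj t) ((P ◁ (baseDiagram K B s₁).map ρ₁) ≫ g), ?_⟩
  have e := pullback_map_sliceHom (baseLeg K B s₁ t) (P := P) ((P ◁ (baseDiagram K B s₁).map ρ₁) ≫ g)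
  rw [← MonoidalCategory.whiskerLeft_comp_assoc, baseLeg_comp_map', hg, sliceHom_unsliceHom] at e
  simpa only [Category.assoc] using (Iso.eq_comp_inv _).mpr e

variable {B s₁ P}

/-- **Lifts restrict to finer stages**: if `ψ : P_{t'} ⟶ P_{t'}` restricts to `φ` over `Spec B`, so does its base
change `P_t ⟶ P_t` along `Spec K[t] → Spec K[t']` (read through `P_{t'} ×_{K[t']} K[t] ≅ P_t`), `t ⊇ t'`.
[cite: GortzWedhorn2020, §(4.7) (4.7.1) and Prop. 4.16] -/
theorem map_restrictStage_eq_conj {t t' : (Idx B s₁)ᵒᵖ} (ρ : t ⟶ t') (φ : limObj B P ⟶ limObj B P)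
    (ψ : stageObj B s₁ P t' ⟶ stageObj B s₁ P t')
    (hψ : (legPullback K B s₁ t').map ψ =
      (legFacObjIso B s₁ t' P).hom ≫ φ ≫ (legFacObjIso B s₁ t' P).inv) :
    (legPullback K B s₁ t).map
        (sliceHom ((baseDiagram K B s₁).obj t)
          ((P ◁ (baseDiagram K B s₁).map ρ) ≫ unsliceHom ((baseDiagram K B s₁).obj t') ψ)) =
      (legFacObjIso B s₁ t P).hom ≫ φ ≫ (legFacObjIso B s₁ t P).inv := by
  have e := pullback_map_sliceHom (baseLeg K B s₁ t) (P := P)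
    ((P ◁ (baseDiagram K B s₁).map ρ) ≫ unsliceHom ((baseDiagram K B s₁).obj t') ψ)
  -- the restriction of `unsliceHom ψ` to `P ⊗ Spec B` is `unsliceHom φ`
  have hres : (P ◁ baseLeg K B s₁ t') ≫ unsliceHom ((baseDiagram K B s₁).obj t') ψ =
      unsliceHom (specOver K B) φ := by
    rw [whiskerLeft_comp_unsliceHom (baseLeg K B s₁ t') ψ, hψ]
    simp only [Category.assoc, Iso.inv_hom_id_assoc, Iso.inv_hom_id, Category.comp_id]
  rw [← MonoidalCategory.whiskerLeft_comp_assoc, baseLeg_comp_map', hres, sliceHom_unsliceHom] at e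
  simpa only [Category.assoc] using (Iso.eq_comp_inv _).mpr e

/-- **Finitely many endomorphisms of `P_B` come from ONE stage** (common refinement of the stages of
`exists_stage_map_eq_conj`). [cite: StacksProject, Tag 01ZC] [cite: EGAIV3, Thm. 8.8.2 (i)] -/
theorem exists_stage_forall_map_eq_conj [QuasiCompact P.hom] [QuasiSeparated P.hom]
    [LocallyOfFinitePresentation P.hom] {J : Type*} [Finite J] (t₀ : (Idx B s₁)ᵒᵖ)
    (φ : J → (limObj B P ⟶ limObj B P)) :
    ∃ (t : (Idx B s₁)ᵒᵖ) (_ : t ⟶ t₀) (ψ : J → (stageObj B s₁ P t ⟶ stageObj B s₁ P t)),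
      ∀ i, (legPullback K B s₁ t).map (ψ i) =
        (legFacObjIso B s₁ t P).hom ≫ φ i ≫ (legFacObjIso B s₁ t P).inv := by
  classical
  choose t ρ ψ hψ using fun i => exists_stage_map_eq_conj B s₁ P t₀ (φ i)
  -- a common refinement of `t₀` and the `t i`
  obtain ⟨t', ht'⟩ := exists_hom_of_finite B s₁ (Option.elim · t₀ t)
  obtain ⟨σ₀⟩ := ht' none
  refine ⟨t', σ₀, fun i => sliceHom ((baseDiagram K B s₁).obj t')
      ((P ◁ (baseDiagram K B s₁).map (ht' (some i)).some) ≫ unsliceHom ((baseDiagram K B s₁).obj (t i)) (ψ i)),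
    fun i => map_restrictStage_eq_conj _ (φ i) (ψ i) (hψ i)⟩

/-! ## §3 On a flat separated stage carrying the group law: homomorphisms, uniqueness, relations -/

section Relations

variable {t : (Idx B s₁)ᵒᵖ} [Flat (stageObj B s₁ P t).hom] [IsSeparated (stageObj B s₁ P t).hom]
  [IsSchemeTheoreticallyDominant (baseLeg K B s₁ t).left]

/-- **Lifts are unique**: two endomorphisms of the flat separated stage `P_t` with the same base change to
`Spec B` are equal (`Spec B → Spec K[t]` schematically dominant; `pullback_map_injective_of_flat`).
[cite: EGAIV3, Thm. 8.8.2 (i)] -/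
theorem stage_hom_ext_of_map_eq {ψ ψ' : stageObj B s₁ P t ⟶ stageObj B s₁ P t}
    (h : (legPullback K B s₁ t).map ψ = (legPullback K B s₁ t).map ψ') : ψ = ψ' :=
  pullback_map_injective_of_flat (baseLeg K B s₁ t).left h

/-- **Composites lift to composites**: if `ψᵢ` restricts to `φᵢ` (`i = 1, 2, 3`) and `φ₁ ≫ φ₂ = φ₃`, then
`ψ₁ ≫ ψ₂ = ψ₃`. [cite: EGAIV3, Thm. 8.8.2 (i)] -/
theorem comp_eq_of_map_eq_conj {φ₁ φ₂ φ₃ : limObj B P ⟶ limObj B P}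
    {ψ₁ ψ₂ ψ₃ : stageObj B s₁ P t ⟶ stageObj B s₁ P t}
    (h₁ : (legPullback K B s₁ t).map ψ₁ = (legFacObjIso B s₁ t P).hom ≫ φ₁ ≫ (legFacObjIso B s₁ t P).inv)
    (h₂ : (legPullback K B s₁ t).map ψ₂ = (legFacObjIso B s₁ t P).hom ≫ φ₂ ≫ (legFacObjIso B s₁ t P).inv)
    (h₃ : (legPullback K B s₁ t).map ψ₃ = (legFacObjIso B s₁ t P).hom ≫ φ₃ ≫ (legFacObjIso B s₁ t P).inv)
    (h : φ₁ ≫ φ₂ = φ₃) : ψ₁ ≫ ψ₂ = ψ₃ := by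
  refine stage_hom_ext_of_map_eq ?_
  rw [Functor.map_comp, h₁, h₂, h₃, ← h]
  simp only [Category.assoc, Iso.inv_hom_id_assoc]

omit [Flat (stageObj B s₁ P t).hom] [IsSeparated (stageObj B s₁ P t).hom]
  [IsSchemeTheoreticallyDominant (baseLeg K B s₁ t).left] in
/-- The identity of `P_t` restricts to the identity of `P_B` (the unit of the presentation: with `comp_eq_of_map_eq_conj`
and `lift_mul_eq_of_map_eq_conj`, relations mentioning `𝟙` descend as well). [cite: EGAIV3, Thm. 8.8.2 (i)] -/
theorem map_id_eq_conj :
    (legPullback K B s₁ t).map (𝟙 (stageObj B s₁ P t)) =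
      (legFacObjIso B s₁ t P).hom ≫ 𝟙 (limObj B P) ≫ (legFacObjIso B s₁ t P).inv := by
  rw [CategoryTheory.Functor.map_id, Category.id_comp, Iso.hom_inv_id]

variable [GrpObj (limObj B P)]

/-- **A lift of a homomorphism is a homomorphism.**  Let the group law of `P_B` be descended to the stage `P_t`
(`d : GrpSpread B s₁ P t`, structure `d.grpObj`), `φ` a homomorphism of the `B`-group scheme `P_B`, and `ψ` an
endomorphism of `P_t` restricting to `φ`.  Then `ψ` is a homomorphism of the `K[t]`-group scheme `P_t`: its base
change `e ∘ φ ∘ e⁻¹` is a homomorphism for the transported structure on `(P_t)_B` (`e : (P_t)_B ≅ P_B` is one), and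
§1 applies to `d.liftedGrpData`. [cite: EGAIV3, Thm. 8.8.2 (i)] [cite: StacksProject, Tag 01ZM] -/
theorem GrpSpread.isMonHom_of_map_eq_conj (d : GrpSpread B s₁ P t) (φ : limObj B P ⟶ limObj B P)
    [IsMonHom φ] (ψ : stageObj B s₁ P t ⟶ stageObj B s₁ P t)
    (hψ : (legPullback K B s₁ t).map ψ =
      (legFacObjIso B s₁ t P).hom ≫ φ ≫ (legFacObjIso B s₁ t P).inv) :
    letI : GrpObj (stageObj B s₁ P t) := d.grpObj
    IsMonHom ψ := by
  -- the structure on `(P_t)_B` transported from `P_B` (the one `d.liftedGrpData` lifts)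
  letI := grpObjLegObj (B := B) (s₁ := s₁) (P := P) t
  haveI : IsMonHom (legFacObjIso B s₁ t P).symm.hom := isMonHom_ofIso (legFacObjIso B s₁ t P).symm
  haveI : IsMonHom (legFacObjIso B s₁ t P).hom :=
    inferInstanceAs (IsMonHom (legFacObjIso B s₁ t P).symm.inv)
  haveI : IsMonHom (legFacObjIso B s₁ t P).inv :=
    inferInstanceAs (IsMonHom (legFacObjIso B s₁ t P).symm.hom)
  haveI : IsMonHom ((legPullback K B s₁ t).map ψ) := by
    rw [hψ]; infer_instance
  exact d.liftedGrpData.isMonHom_of_map ψ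

/-- **Products lift to products**: for the descended group law `d.grpObj` on `P_t`, if `ψᵢ` restricts to `φᵢ`
(`i = 1, 2, 3`) and `φ₃ = (φ₁, φ₂) ≫ μ` is the product of `φ₁, φ₂` in the group `Hom(P_B, P_B)`, then
`ψ₃ = (ψ₁, ψ₂) ≫ μ` in `Hom(P_t, P_t)` — so every finite presentation (generators and polynomial relations in
composition and product) of a ring of endomorphisms of `P_B` descends to `P_t`. [cite: EGAIV3, Thm. 8.8.2 (i)] -/
theorem lift_mul_eq_of_map_eq_conj (d : GrpSpread B s₁ P t) {φ₁ φ₂ φ₃ : limObj B P ⟶ limObj B P}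
    {ψ₁ ψ₂ ψ₃ : stageObj B s₁ P t ⟶ stageObj B s₁ P t}
    (h₁ : (legPullback K B s₁ t).map ψ₁ = (legFacObjIso B s₁ t P).hom ≫ φ₁ ≫ (legFacObjIso B s₁ t P).inv)
    (h₂ : (legPullback K B s₁ t).map ψ₂ = (legFacObjIso B s₁ t P).hom ≫ φ₂ ≫ (legFacObjIso B s₁ t P).inv)
    (h₃ : (legPullback K B s₁ t).map ψ₃ = (legFacObjIso B s₁ t P).hom ≫ φ₃ ≫ (legFacObjIso B s₁ t P).inv)
    (h : lift φ₁ φ₂ ≫ μ[limObj B P] = φ₃) :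
    lift ψ₁ ψ₂ ≫ d.grpObj.mul = ψ₃ := by
  letI := grpObjLegObj (B := B) (s₁ := s₁) (P := P) t
  refine stage_hom_ext_of_map_eq ?_
  rw [Functor.map_comp, h₃, ← h]
  change (legPullback K B s₁ t).map (lift ψ₁ ψ₂) ≫ (legPullback K B s₁ t).map d.mul = _
  rw [d.map_mul, lift_δ_assoc, h₁, h₂, MonObj.ofIso_mul]
  simp only [Iso.symm_inv, Iso.symm_hom, Category.assoc]
  rw [← Category.assoc (lift _ _), CartesianMonoidalCategory.lift_map]
  simp only [Category.assoc, Iso.inv_hom_id, Category.comp_id]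
  rw [← CartesianMonoidalCategory.comp_lift_assoc]

end Relations

end SubalgGrpSpread

end Literature.AlgebraicGeometry.Limits

end
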